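import Literature.Probability.Percolation.SlabRSWProp39Iter
import HarnessLib

/-!
# Newman–Tassion–Wu 2017, §3.3 — Proposition 3.9, item 2

Topic: `Literature/Probability/Percolation`. The second comparison of Proposition 3.9:
`f_p(n, n + κn) ≥ 1 - (1 - f_p(n, n + 2κn))^{1/3}` — a top-down crossing of
`R' = [-κn, n+κn] × [0,n]` crosses `[-κn, n] × [0,n]` or `[0, n+κn] × [0,n]` from top to bottom,
or the square `[0,n]²` from left to right; the three events have probability at most
`f_p(n, n+κn)`, and the square-root trick (with exponent `1/3`) applies.

* `tb_crossing_trichotomy` — the deterministic decomposition of a top-down crossing.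
* `prop39_item2_one_step` — PROVED: for `0 ≤ m`, `3 ≤ n`:
  `1 - (1 - P_p[T ⟷ B in [-m,n+m]×[0,n]])^{1/3} ≤ P_p[L ⟷ R in [0,n]×[0,n+m]]`.

## Sources

* C. M. Newman, V. Tassion, W. Wu, *Critical percolation and the minimal spanning tree in slabs*,
  Comm. Pure Appl. Math. 70 (2017), arXiv:1512.09107: §3.3, Proposition 3.9 (2) and its proof
  ("at least one of the following three events must occur") [NewmanTassionWu2017].
-/

noncomputable section

namespace Literature.Probability.Percolation

open MeasureTheory LatticeModels SimpleGraph

namespace NTW17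

variable {k : ℕ}

/-- **The trichotomy for a top-down crossing** (proof of Prop. 3.9 (2)): for `a ≤ b` (and
any `a', b'`), an `ω`-open top-down crossing of `[a',b'] × [c,d]` (lattice configuration)
either stays in `[a',b]`, or stays in `[a,b']`, or contains a left-right crossing of `[a,b] × [c,d]`.
[cite: NewmanTassionWu2017, §3.3 (proof of Proposition 3.9 (2), the three events)] -/
theorem tb_crossing_trichotomy {a' a b b' c d : ℤ} (hab : a ≤ b)
    {ω : BondConfig (slab 3 k)} (hω : ω ⊆ (slabGraph 3 k).edgeSet)
    (h : ω ∈ slabConn k (boxR a' b' c d) {z | z.2 = d} {z | z.2 = c}) :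
    ω ∈ slabConn k (boxR a' b c d) {z | z.2 = d} {z | z.2 = c} ∨
      ω ∈ slabConn k (boxR a b' c d) {z | z.2 = d} {z | z.2 = c} ∨
      ω ∈ slabConn k (boxR a b c d) {z | z.1 = a} {z | z.1 = b} := by
  obtain ⟨l, hl⟩ := (mem_slabConn_iff_exists_isOSAP ω _ _ _).1 h
  have hbox : ∀ v ∈ l, a' ≤ (planar k v).1 ∧ (planar k v).1 ≤ b' ∧ c ≤ (planar k v).2 ∧ (planar k v).2 ≤ d := by
    intro v hv; have := hl.subset v hv; rwa [mem_slabLift_iff, mem_boxR_iff] at this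
  have hch := isChain_adj_of_isChain_open hω hl.chain
  -- steps change the first coordinate by at most one
  have hstep : ∀ {m₁ m₂ : List (slab 3 k)} (h₁ : m₁ ≠ []) (h₂ : m₂ ≠ []), l = m₁ ++ m₂ →
      (planar k (m₂.head h₂)).1 ≤ (planar k (m₁.getLast h₁)).1 + 1 ∧
        (planar k (m₁.getLast h₁)).1 ≤ (planar k (m₂.head h₂)).1 + 1 := by
    intro m₁ m₂ h₁ h₂ heq
    rw [heq] at hch
    have h1 := planar_mem_sqBox_one_of_adj (hch.rel_getLast_head_of_append h₁ h₂)
    rw [mem_sqBox_iff'] at h1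
    push_cast at h1
    omega
  by_cases hB : ∀ v ∈ l, (planar k v).1 ≤ b
  · left
    exact (mem_slabConn_iff_exists_isOSAP ω _ _ _).2 ⟨l, ⟨hl.nodup, hl.chain,
      fun v hv => by rw [mem_slabLift_iff, mem_boxR_iff]; have := hbox v hv; have := hB v hv; omega,
      hl.ne_nil, hl.head_mem, hl.last_mem⟩⟩
  by_cases hA : ∀ v ∈ l, a ≤ (planar k v).1
  · right; left
    exact (mem_slabConn_iff_exists_isOSAP ω _ _ _).2 ⟨l, ⟨hl.nodup, hl.chain,
      fun v hv => by rw [mem_slabLift_iff, mem_boxR_iff]; have := hbox v hv; have := hA v hv; omega,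
      hl.ne_nil, hl.head_mem, hl.last_mem⟩⟩
  right; right
  push Not at hA hB
  -- a segment of `l` inside `[a,b] × [c,d]` joining the two columns
  have hseg : ∃ (pre seg post : List (slab 3 k)) (hs : seg ≠ []), l = pre ++ seg ++ post ∧
      (∀ v ∈ seg, a ≤ (planar k v).1 ∧ (planar k v).1 ≤ b) ∧
      (((planar k (seg.head hs)).1 = a ∧ (planar k (seg.getLast hs)).1 = b) ∨
        ((planar k (seg.head hs)).1 = b ∧ (planar k (seg.getLast hs)).1 = a)) := by
    -- the first vertex `u` to the right of `b`
    obtain ⟨p, u, s, hl1, hu, hp⟩ := exists_first_split (p := fun v => b < (planar k v).1) l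
      (by obtain ⟨v, hv, hvb⟩ := hB; exact ⟨v, hv, hvb⟩)
    simp only [not_lt] at hp
    by_cases hpA : ∃ v ∈ p, (planar k v).1 < a
    · -- the last vertex `w` of `p` to the left of `a`; the segment after it, up to `u`
      obtain ⟨p₁, w, p₂, hp1, hw, hp₂⟩ := exists_last_split (p := fun v => (planar k v).1 < a) p hpA
      simp only [not_lt] at hp₂
      have hp₂ne : p₂ ≠ [] := by
        rintro rfl
        have := hstep (m₁ := p₁ ++ [w]) (m₂ := u :: s) (by simp) (by simp) (by simp [hl1, hp1])
        simp at this
        omega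
      refine ⟨p₁ ++ [w], p₂, u :: s, hp₂ne, by rw [hl1, hp1]; simp, fun v hv =>
        ⟨hp₂ v hv, hp v (by rw [hp1]; simp [hv])⟩, Or.inl ⟨?_, ?_⟩⟩
      · have := hstep (m₁ := p₁ ++ [w]) (m₂ := p₂ ++ u :: s) (by simp) (by simp [hp₂ne])
          (by simp [hl1, hp1])
        rw [List.getLast_append_of_ne_nil _ (by simp), List.getLast_singleton,
          List.head_append_of_ne_nil hp₂ne] at this
        have h2 := hp₂ _ (List.head_mem hp₂ne)
        omega
      · have := hstep (m₁ := p₁ ++ w :: p₂) (m₂ := u :: s) (by simp) (by simp) (by simp [hl1, hp1])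
        rw [List.head_cons] at this
        have e : (p₁ ++ w :: p₂).getLast (by simp) = p₂.getLast hp₂ne := by
          rw [List.getLast_append_of_ne_nil _ (by simp), List.getLast_cons hp₂ne]
        rw [e] at this
        have h2 := hp _ (by rw [hp1]; exact List.mem_append_right _ (List.mem_cons_of_mem _ (List.getLast_mem hp₂ne)))
        omega
    · -- all of `p` is in `[a, b]`; the first vertex `w` of `u :: s` to the left of `a`
      push Not at hpA
      obtain ⟨v₀, hv₀, hv₀a⟩ := hA
      have hv₀s : v₀ ∈ u :: s := by
        rw [hl1] at hv₀
        rcases List.mem_append.1 hv₀ with h | h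
        · exact absurd hv₀a (not_lt.2 (hpA v₀ h))
        · exact h
      obtain ⟨q, w, t, hq1, hw, hq⟩ := exists_first_split (p := fun v => (planar k v).1 < a) (u :: s)
        ⟨v₀, hv₀s, hv₀a⟩
      simp only [not_lt] at hq
      -- the last vertex `u'` of `q` to the right of `b` (`u ∈ q`)
      have hqne : q ≠ [] := by
        rintro rfl
        simp only [List.nil_append, List.cons.injEq] at hq1
        rw [← hq1.1] at hw
        omega
      have huq : u ∈ q := by
        have := congrArg List.head? hq1
        rw [List.head?_cons] at this
        cases q with
        | nil => exact absurd rfl hqne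
        | cons q0 q' => simp at this; rw [this]; simp
      obtain ⟨q₁, u', q₂, hq2, hu', hq₂⟩ := exists_last_split (p := fun v => b < (planar k v).1) q
        ⟨u, huq, hu⟩
      simp only [not_lt] at hq₂
      have hl2 : l = p ++ (q₁ ++ u' :: q₂) ++ w :: t := by rw [hl1, hq1, hq2]; simp
      have hq₂ne : q₂ ≠ [] := by
        rintro rfl
        have := hstep (m₁ := p ++ q₁ ++ [u']) (m₂ := w :: t) (by simp) (by simp) (by simp [hl2])
        simp at this
        omega
      refine ⟨p ++ q₁ ++ [u'], q₂, w :: t, hq₂ne, by rw [hl2]; simp, fun v hv =>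
        ⟨hq v (by rw [hq2]; simp [hv]), hq₂ v hv⟩, Or.inr ⟨?_, ?_⟩⟩
      · have := hstep (m₁ := p ++ q₁ ++ [u']) (m₂ := q₂ ++ w :: t) (by simp) (by simp [hq₂ne])
          (by simp [hl2])
        rw [List.getLast_append_of_ne_nil _ (by simp), List.getLast_singleton,
          List.head_append_of_ne_nil hq₂ne] at this
        have h2 := hq₂ _ (List.head_mem hq₂ne)
        omega
      · have := hstep (m₁ := p ++ q₁ ++ u' :: q₂) (m₂ := w :: t) (by simp) (by simp) (by simp [hl2])
        rw [List.head_cons] at this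
        have e : (p ++ q₁ ++ u' :: q₂).getLast (by simp) = q₂.getLast hq₂ne := by
          rw [List.getLast_append_of_ne_nil _ (by simp), List.getLast_cons hq₂ne]
        rw [e] at this
        have h2 := hq _ (by rw [hq2]; exact List.mem_append_right _ (List.mem_cons_of_mem _ (List.getLast_mem hq₂ne)))
        omega
  obtain ⟨pre, seg, post, hs, hleq, hsegx, hends⟩ := hseg
  -- the segment is an open self-avoiding path inside `[a,b] × [c,d]`
  have hsegO : ∀ (X Y : Set (ℤ × ℤ)), planar k (seg.head hs) ∈ X → planar k (seg.getLast hs) ∈ Y →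
      ω ∈ slabConn k (boxR a b c d) X Y := by
    intro X Y hX hY
    refine (mem_slabConn_iff_exists_isOSAP ω _ _ _).2 ⟨seg, ⟨?_, ?_, ?_, hs, fun h => ?_, fun h => ?_⟩⟩
    · have := hl.nodup; rw [hleq] at this
      exact this.sublist ((List.sublist_append_right pre seg).trans (List.sublist_append_left _ post))
    · have := hl.chain; rw [hleq] at this
      exact this.left_of_append.right_of_append
    · intro v hv
      rw [mem_slabLift_iff, mem_boxR_iff]
      have h1 := hbox v (by rw [hleq]; simp [hv])
      have h2 := hsegx v hv
      omega
    · rw [mem_slabLift_iff]; exact hX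
    · rw [mem_slabLift_iff]; exact hY
  rcases hends with ⟨h1, h2⟩ | ⟨h1, h2⟩
  · exact hsegO _ _ h1 h2
  · exact slabConn_comm (hsegO _ _ h1 h2)

/-- **NTW 2017, Proposition 3.9 (2), one step**: for `0 ≤ m` and a rectangle height `n`,
`1 - (1 - P_p[T ⟷ B in [-m,n+m]×[0,n]])^{1/3} ≤ P_p[L ⟷ R in [0,n]×[0,n+m]]`
(that is, `f_p(n, n+κn) ≥ 1 - (1 - f_p(n, n+2κn))^{1/3}`).
[cite: NewmanTassionWu2017, §3.3 (Proposition 3.9 (2), proof)] -/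
theorem prop39_item2_one_step {n m : ℤ} (hm : 0 ≤ m) (hn : 0 ≤ n) (p : unitInterval) :
    1 - (1 - (bondPercolation (slabGraph 3 k) p).real
        (slabConn k (boxR (-m) (n + m) 0 n) {z | z.2 = n} {z | z.2 = 0})) ^ ((3 : ℝ)⁻¹) ≤
      (bondPercolation (slabGraph 3 k) p).real
        (slabConn k (boxR 0 n 0 (n + m)) {z | z.1 = 0} {z | z.1 = n}) := by
  classical
  set P := bondPercolation (slabGraph 3 k) p with hP
  -- the three events
  set E₁ := slabConn k (boxR (-m) n 0 n) {z : ℤ × ℤ | z.2 = n} {z | z.2 = 0} with hE₁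
  set E₂ := slabConn k (boxR 0 (n + m) 0 n) {z : ℤ × ℤ | z.2 = n} {z | z.2 = 0} with hE₂
  set E₃ := slabConn k (boxR 0 n 0 n) {z : ℤ × ℤ | z.1 = 0} {z | z.1 = n} with hE₃
  let A : Fin 3 → Set (BondConfig (slab 3 k)) := ![E₁, E₂, E₃]
  have hA0 : A 0 = E₁ := rfl
  have hA1 : A 1 = E₂ := rfl
  have hA2 : A 2 = E₃ := rfl
  have hAup : ∀ i, IsUpperSet (A i) := by
    intro i; fin_cases i <;> exact isUpperSet_openCrossing _ _ _
  have hAm : ∀ i, MeasurableSet (A i) := by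
    intro i; fin_cases i <;> exact measurableSet_slabConn_boxR _ _ _ _ _ _
  -- the union contains the top-down crossing of `R'` (almost surely: lattice configurations)
  have hcover : ∀ᵐ ω ∂P, ω ∈ slabConn k (boxR (-m) (n + m) 0 n) {z | z.2 = n} {z | z.2 = 0} →
      ω ∈ ⋃ i, A i := by
    filter_upwards [ae_subset_edgeSet (slabGraph 3 k) p] with ω hω h
    rcases tb_crossing_trichotomy (a' := -m) (a := 0) (b := n) (b' := n + m) hn hω h with h | h | h
    · exact Set.mem_iUnion.2 ⟨0, h⟩
    · exact Set.mem_iUnion.2 ⟨1, h⟩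
    · exact Set.mem_iUnion.2 ⟨2, h⟩
  have hU : P.real (slabConn k (boxR (-m) (n + m) 0 n) {z | z.2 = n} {z | z.2 = 0}) ≤ P.real (⋃ i, A i) := by
    simp only [measureReal_def]
    exact ENNReal.toReal_mono (measure_ne_top _ _) (measure_mono_ae hcover)
  -- each of the three events has probability at most `f_p(n, n+m)`
  set f := P.real (slabConn k (boxR 0 n 0 (n + m)) {z : ℤ × ℤ | z.1 = 0} {z | z.1 = n}) with hf
  have htb : ∀ a : ℤ, P.real (slabConn k (boxR a (a + (n + m)) 0 n) {z : ℤ × ℤ | z.2 = n} {z | z.2 = 0}) = f := by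
    intro a
    -- top-down of an `(n+m) × n` rectangle = left-right of the `n × (n+m)` rectangle
    have h1 : P.real (slabConn k (boxR a (a + (n + m)) 0 n) {z : ℤ × ℤ | z.2 = n} {z | z.2 = 0}) =
        P.real (slabConn k (boxR a (a + (n + m)) 0 n) {z : ℤ × ℤ | z.2 = 0} {z | z.2 = n}) := by
      congr 1; ext ω; exact ⟨slabConn_comm, slabConn_comm⟩
    rw [h1, real_bt_eq_lr]
    have := real_lr_shift (k := k) ((0 : ℤ), a) 0 n 0 (n + m) p
    simp only [add_zero, zero_add] at this
    rw [show a + (n + m) = n + m + a by ring]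
    exact this
  have hAle : ∀ i, P.real (A i) ≤ f := by
    intro i; fin_cases i
    · show P.real E₁ ≤ f
      have := htb (-m); rw [show -m + (n + m) = n by ring] at this
      exact this.le
    · show P.real E₂ ≤ f
      have := htb 0; rw [zero_add] at this
      exact this.le
    · show P.real E₃ ≤ f
      exact real_lr_le_taller (k := k) (a := 0) (b := n) (c := 0) (d := n) (c' := 0) (d' := n + m)
        le_rfl (by omega) p
  obtain ⟨i, hi⟩ := sqrt_trick_holds (slabGraph 3 k) p A hAup hAm
  have hcard : ((Fintype.card (Fin 3) : ℝ))⁻¹ = (3 : ℝ)⁻¹ := by norm_num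
  rw [hcard] at hi
  refine le_trans ?_ (hi.trans (hAle i))
  have h1 : P.real (⋃ i, A i) ≤ 1 := measureReal_le_one
  have h2 : 0 ≤ 1 - P.real (⋃ i, A i) := by linarith
  gcongr

/-- **NTW 2017, Proposition 3.9 (2), the induction step** (two widths): for `0 ≤ m' ≤ m`,
`1 - (1 - P_p[T ⟷ B in [-m',n+m]×[0,n]])^{1/3} ≤ P_p[L ⟷ R in [0,n]×[0,n+m]]`
(that is, `f_p(n, n+m) ≥ 1 - (1 - f_p(n, n+m+m'))^{1/3}`).
[cite: NewmanTassionWu2017, §3.3 (Proposition 3.9 (2), proof)] -/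
theorem prop39_item2_step {n m m' : ℤ} (hm' : 0 ≤ m') (hmm : m' ≤ m) (hn : 0 ≤ n) (p : unitInterval) :
    1 - (1 - (bondPercolation (slabGraph 3 k) p).real
        (slabConn k (boxR (-m') (n + m) 0 n) {z | z.2 = n} {z | z.2 = 0})) ^ ((3 : ℝ)⁻¹) ≤
      (bondPercolation (slabGraph 3 k) p).real
        (slabConn k (boxR 0 n 0 (n + m)) {z | z.1 = 0} {z | z.1 = n}) := by
  classical
  set P := bondPercolation (slabGraph 3 k) p with hP
  -- the three events
  set E₁ := slabConn k (boxR (-m') n 0 n) {z : ℤ × ℤ | z.2 = n} {z | z.2 = 0} with hE₁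
  set E₂ := slabConn k (boxR 0 (n + m) 0 n) {z : ℤ × ℤ | z.2 = n} {z | z.2 = 0} with hE₂
  set E₃ := slabConn k (boxR 0 n 0 n) {z : ℤ × ℤ | z.1 = 0} {z | z.1 = n} with hE₃
  let A : Fin 3 → Set (BondConfig (slab 3 k)) := ![E₁, E₂, E₃]
  have hA0 : A 0 = E₁ := rfl
  have hA1 : A 1 = E₂ := rfl
  have hA2 : A 2 = E₃ := rfl
  have hAup : ∀ i, IsUpperSet (A i) := by
    intro i; fin_cases i <;> exact isUpperSet_openCrossing _ _ _
  have hAm : ∀ i, MeasurableSet (A i) := by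
    intro i; fin_cases i <;> exact measurableSet_slabConn_boxR _ _ _ _ _ _
  -- the union contains the top-down crossing of `R'` (almost surely: lattice configurations)
  have hcover : ∀ᵐ ω ∂P, ω ∈ slabConn k (boxR (-m') (n + m) 0 n) {z | z.2 = n} {z | z.2 = 0} →
      ω ∈ ⋃ i, A i := by
    filter_upwards [ae_subset_edgeSet (slabGraph 3 k) p] with ω hω h
    rcases tb_crossing_trichotomy (a' := -m') (a := 0) (b := n) (b' := n + m) hn hω h with h | h | h
    · exact Set.mem_iUnion.2 ⟨0, h⟩
    · exact Set.mem_iUnion.2 ⟨1, h⟩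
    · exact Set.mem_iUnion.2 ⟨2, h⟩
  have hU : P.real (slabConn k (boxR (-m') (n + m) 0 n) {z | z.2 = n} {z | z.2 = 0}) ≤ P.real (⋃ i, A i) := by
    simp only [measureReal_def]
    exact ENNReal.toReal_mono (measure_ne_top _ _) (measure_mono_ae hcover)
  -- each of the three events has probability at most `f_p(n, n+m)`
  set f := P.real (slabConn k (boxR 0 n 0 (n + m)) {z : ℤ × ℤ | z.1 = 0} {z | z.1 = n}) with hf
  have htb : ∀ a w : ℤ, P.real (slabConn k (boxR a (a + (n + w)) 0 n) {z : ℤ × ℤ | z.2 = n} {z | z.2 = 0}) =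
      P.real (slabConn k (boxR 0 n 0 (n + w)) {z : ℤ × ℤ | z.1 = 0} {z | z.1 = n}) := by
    intro a w
    -- top-down of an `(n+w) × n` rectangle = left-right of the `n × (n+w)` rectangle
    have h1 : P.real (slabConn k (boxR a (a + (n + w)) 0 n) {z : ℤ × ℤ | z.2 = n} {z | z.2 = 0}) =
        P.real (slabConn k (boxR a (a + (n + w)) 0 n) {z : ℤ × ℤ | z.2 = 0} {z | z.2 = n}) := by
      congr 1; ext ω; exact ⟨slabConn_comm, slabConn_comm⟩
    rw [h1, real_bt_eq_lr]
    have := real_lr_shift (k := k) ((0 : ℤ), a) 0 n 0 (n + w) p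
    simp only [add_zero, zero_add] at this
    rw [show a + (n + w) = n + w + a by ring]
    exact this
  have hAle : ∀ i, P.real (A i) ≤ f := by
    intro i; fin_cases i
    · show P.real E₁ ≤ f
      have := htb (-m') m'; rw [show -m' + (n + m') = n by ring] at this
      rw [hE₁, this]
      exact real_lr_le_taller (k := k) (a := 0) (b := n) (c := 0) (d := n + m') (c' := 0) (d' := n + m)
        le_rfl (by omega) p
    · show P.real E₂ ≤ f
      have := htb 0 m; rw [zero_add] at this
      exact this.le
    · show P.real E₃ ≤ f
      exact real_lr_le_taller (k := k) (a := 0) (b := n) (c := 0) (d := n) (c' := 0) (d' := n + m)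
        le_rfl (by omega) p
  obtain ⟨i, hi⟩ := sqrt_trick_holds (slabGraph 3 k) p A hAup hAm
  have hcard : ((Fintype.card (Fin 3) : ℝ))⁻¹ = (3 : ℝ)⁻¹ := by norm_num
  rw [hcard] at hi
  refine le_trans ?_ (hi.trans (hAle i))
  have h1 : P.real (⋃ i, A i) ≤ 1 := measureReal_le_one
  have h2 : 0 ≤ 1 - P.real (⋃ i, A i) := by linarith
  gcongr

/-- Top-down crossings of `[a, a+w] × [0,n]` have the probability `f_p(n, w)` of left-right crossings of
`[0,n] × [0,w]` (translation and transposition). [cite: NewmanTassionWu2017, §3.3 ("by symmetry")] -/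
theorem real_tb_eq_f (a w n : ℤ) (p : unitInterval) :
    (bondPercolation (slabGraph 3 k) p).real (slabConn k (boxR a (a + w) 0 n) {z | z.2 = n} {z | z.2 = 0}) =
      (bondPercolation (slabGraph 3 k) p).real (slabConn k (boxR 0 n 0 w) {z | z.1 = 0} {z | z.1 = n}) := by
  have h1 : (bondPercolation (slabGraph 3 k) p).real (slabConn k (boxR a (a + w) 0 n) {z | z.2 = n} {z | z.2 = 0}) =
      (bondPercolation (slabGraph 3 k) p).real (slabConn k (boxR a (a + w) 0 n) {z | z.2 = 0} {z | z.2 = n}) := by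
    congr 1; ext ω; exact ⟨slabConn_comm, slabConn_comm⟩
  rw [h1, real_bt_eq_lr]
  have := real_lr_shift (k := k) ((0 : ℤ), a) 0 n 0 w p
  simp only [add_zero, zero_add] at this
  rw [show a + w = w + a by ring]
  exact this

/-- **NTW 2017, Proposition 3.9 (2), iterated form**: with `G_j = f_p(n, n + jm) =
P_p[L ⟷ R in [0,n] × [0, n+jm]]`, for every `j ≥ 1`: `1 - (1 - G_{j+1})^{1/3} ≤ G_j`
(hence `f_p(n, n+κn) ≥ h^{j-1}(f_p(n, n+jκn))` with `h(x) = 1 - (1-x)^{1/3}`).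
[cite: NewmanTassionWu2017, §3.3 (Proposition 3.9 (2))] -/
theorem prop39_item2 {n m : ℤ} {j : ℕ} (hj : 1 ≤ j) (hm : 0 ≤ m) (hn : 0 ≤ n) (p : unitInterval) :
    1 - (1 - (bondPercolation (slabGraph 3 k) p).real
        (slabConn k (boxR 0 n 0 (n + (j + 1) * m)) {z | z.1 = 0} {z | z.1 = n})) ^ ((3 : ℝ)⁻¹) ≤
      (bondPercolation (slabGraph 3 k) p).real
        (slabConn k (boxR 0 n 0 (n + j * m)) {z | z.1 = 0} {z | z.1 = n}) := by
  have hjm : m ≤ (j : ℤ) * m := by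
    have : (1 : ℤ) * m ≤ (j : ℤ) * m := mul_le_mul_of_nonneg_right (by exact_mod_cast hj) hm
    simpa using this
  have h := prop39_item2_step (k := k) (n := n) (m := j * m) (m' := m) hm hjm hn p
  have ht := real_tb_eq_f (k := k) (-m) (n + (j + 1) * m) n p
  rw [show -m + (n + (↑j + 1) * m) = n + ↑j * m by ring] at ht
  rw [ht] at h
  exact h

/-- The top-down crossing of `[-m', n+m] × [0,n]` has probability `f_p(n, n+m+m')` (the left-right
crossing probability of `[0,n] × [0, n+m+m']`). [cite: NewmanTassionWu2017, §3.3 (proof of Proposition 3.9 (2), "by symmetry")] -/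
theorem real_tb_eq_lr_wide (n m m' : ℤ) (p : unitInterval) :
    (bondPercolation (slabGraph 3 k) p).real (slabConn k (boxR (-m') (n + m) 0 n) {z | z.2 = n} {z | z.2 = 0}) =
      (bondPercolation (slabGraph 3 k) p).real (slabConn k (boxR 0 n 0 (n + m + m')) {z | z.1 = 0} {z | z.1 = n}) := by
  have h1 : (bondPercolation (slabGraph 3 k) p).real (slabConn k (boxR (-m') (n + m) 0 n) {z : ℤ × ℤ | z.2 = n} {z | z.2 = 0}) =
      (bondPercolation (slabGraph 3 k) p).real (slabConn k (boxR (-m') (n + m) 0 n) {z : ℤ × ℤ | z.2 = 0} {z | z.2 = n}) := by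
    congr 1; ext ω; exact ⟨slabConn_comm, slabConn_comm⟩
  rw [h1, real_bt_eq_lr]
  have h := real_lr_shift (k := k) ((0 : ℤ), m') 0 n (-m') (n + m) p
  dsimp only at h
  have e1 : -m' + m' = 0 := by ring
  simp only [add_zero, e1] at h
  exact h.symm

/-- **NTW 2017, Proposition 3.9 (2), the induction step in `f`-form**: for `0 ≤ m' ≤ m` and
`0 ≤ n`, `1 - (1 - f_p(n, n+m+m'))^{1/3} ≤ f_p(n, n+m)`, both crossings written as left-right
crossings of rectangles anchored at the origin. [cite: NewmanTassionWu2017, §3.3 (Proposition 3.9 (2))] -/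
theorem prop39_item2_step' {n m m' : ℤ} (hm' : 0 ≤ m') (hmm : m' ≤ m) (hn : 0 ≤ n) (p : unitInterval) :
    1 - (1 - (bondPercolation (slabGraph 3 k) p).real
        (slabConn k (boxR 0 n 0 (n + m + m')) {z | z.1 = 0} {z | z.1 = n})) ^ ((3 : ℝ)⁻¹) ≤
      (bondPercolation (slabGraph 3 k) p).real (slabConn k (boxR 0 n 0 (n + m)) {z | z.1 = 0} {z | z.1 = n}) := by
  have h := prop39_item2_step (k := k) hm' hmm hn p
  rwa [real_tb_eq_lr_wide] at h

end NTW17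

end Literature.Probability.Percolation
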